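import Literature.MathematicalPhysics.QuantumFieldTheory.Balaban1983to89.B8Prop5JoinSectERec
import Literature.MathematicalPhysics.QuantumFieldTheory.Balaban1983to89.B8SectERemainderCovarianceTowerRec
import Literature.MathematicalPhysics.QuantumFieldTheory.Balaban1983to89.B8Prop5KLevelLettersRec
import Literature.MathematicalPhysics.QuantumFieldTheory.Balaban1983to89.B8Prop5JoinSectELocalRD

/-!
# `Balaban1983to89.B8Prop5JoinSectELocalRDRec` — RECORD TWIN of `B8Prop5JoinSectELocalRD` ([Balaban1985RegularSpaces] Prop. 5 p. 94 joined with Sect. E pp. 95–97 on the INVERSE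
# pair by the LOCAL inversion route, with [4]'s inverse laws on print's domains — JOIN-B ∕ JOIN-C ∕ `hCequiv` discharged) FOR THE SYMMETRISED CENTRED block averaging (0.4) of
# [Balaban1987RG1]; the theorem the record `SockHFP` providers instantiate is `hFP_kLevel_of_sectE_local'_RD`

statement-level skeleton of published theorems with citation tags; proofs where landed; nothing here is a claim about the Yang–Mills mass gap

T. Bałaban, *Spaces of regular gauge field configurations on a lattice and gauge fixing conditions*, Commun. Math. Phys. **99** (1985) 75–102
`[Balaban1985RegularSpaces]` ("[6]"): Prop. 5 (1.107)–(1.109) p. 94, (1.92) p. 91, (1.95)–(1.106) pp. 92–94, (1.112)–(1.121) pp. 95–97, (1.78)–(1.79) p. 90, (1.29) p. 81, p. 93;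
T. Bałaban, *Averaging operations for lattice gauge theories*, Commun. Math. Phys. **98** (1985) 17–51 `[Balaban1985Averaging]` ("[3]"): Prop. 10 (203)–(214) p. 50,
(166)–(167) p. 44, (178) p. 45, (22)–(23) p. 21; T. Bałaban, *Propagators for lattice gauge theories in a background field*, Commun. Math. Phys. **99** (1985) 389–434
`[Balaban1985BackgroundPropagators]` ("[4]"): Thm 3.1 p. 397, (3.19)–(3.25) pp. 393–394; T. Bałaban, *Renormalization group approach to lattice gauge field theories. I*,
Commun. Math. Phys. **109** (1987) 249–301 `[Balaban1987RG1]` ("[I]"): (0.3)–(0.4) pp. 252–253.  STATUS: published, refereed.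

CITATION HEADER (lean-in-tree rule).  Cell `pub-ymgap`, «N05-REC» stage 2 (director-ym №254∕№255∕№288), item R5-γ (Prop 5 join for the record; dag-n05-c's remainder list, HANDOFF g26)
— typed by the LEAD PEN dag-n05-e g39 (inventory `N05-REC-INVENTORY.md` §R5 row `B8Prop5JoinSectELocalRD`: A `hFP_kLevel_of_sectE_local'_RD`, `hFP_kLevel_of_sectE_local_RD`,
`hFP_kLevel_of179_local_RD`).  WHAT IS REPRODUCED = ✓ the engine module `B8Prop5JoinSectELocalRD` (seat `pub-ymgap-dag-n04-b` ∕ n19-b lineage) §0–§3 VERBATIM under the token map.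
THEOREM NAMES = the engine's (namespace `…B8Prop5JoinSectELocalRDRec`).  TOKEN MAP: `Cnl ∕ Qnl ∕ Cond179 ∕ InAx ∕ Restr129 ∕ InLambda ∕ glev ∕ QT ↦ CnlZ ∕ QnlZ ∕ Cond179Z ∕ InAxZ ∕
Restr129Z ∕ InLambdaZ ∕ glevZ ∕ QTZ`, `QprimeIter (zdBlocking d L) (bgT L U₀) ↦ QprimeIter (zdBlockingZ d L) (bgTZ L U₀)`; tower `B8Ineq130.tlo ∕ thi ↦ B8Ineq130Rec.tlo ∕ thi`
(CENTRED); regime `(hL : 2 ≤ L) ↦ (hLs : L = 2sL+1) (hs1 : 1 ≤ sL)`, `C0 ↦ C0Z`; the gauge-fixing witness constant `40d·c_B ↦ 20dKZ·c_B` with the record smallness.  Record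
inputs: `B8Prop5JoinSectERec.exists_Dprime_map ∕ restr129_mul_gaugeExp_local ∕ cond179_of_eq114'`, `B8Prop5KLevelLettersRec.multiplier_iff_of_whyZ` (n05-c),
`B8SectERemainderCovarianceTowerRec.Cnl_negStar_inv_of_axial`; structure-free engine inputs REUSED BY NAME (`B8Prop5GaugeParamKLevel.gaugeParam_kLevel ∕ gpar_size`,
`B8Prop5ContractionKLevel.Zsol ∕ Vop ∕ Wsrc ∕ PsiP5`, `B8Eq195Linear.proj325_sub`, `B8Eq195LinearRange.q_g_proj325_range`, `B8LambdaSpaceKLevel.*`, `B8DprimeKLevelLipschitz.smallness_prod`).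
Kind «kernel-checked proof», theorems only; no `def`, no `instance`, no `notation`, no existing module modified.  `--supports stmt-QuantumFields-20541` (K0⁷-keyed, COUNT-NEUTRAL).

## WHAT IS CERTIFIED HERE (kernel; axioms `propext` ∕ `Classical.choice` ∕ `Quot.sound`)
* §1 `hFP_kLevel_of179_local_RD` — JOIN-B with the local inversion route and [4]'s inverse laws on print's domains, record structure (`H_c` a letter).
* §2 `hFP_kLevel_of_sectE_local_RD` — JOIN-C: `H_c λ := −i·H′D′(u₁⁻¹, −iλ)` from the record Sect. E; `hCequiv` displayed.
* §3 `hFP_kLevel_of_sectE_local'_RD` — `hCequiv` DISCHARGED by the record remainder covariance; the theorem the record `SockHFP` providers instantiate.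

HONEST SCOPE: the engine's proofs verbatim under the token map; nothing of Bałaban's analysis newly proved; the LAWS of [4]'s letters (`g Δ q qs Aw c`, `H′`) stay displayed exactly as
in the engine; `HThm4Rec` UNDISCHARGED; caveat (C-S3-1) + addendum v4 stand; N05 [B8] DISCHARGED OF RECORD untouched; N05 ∕ N07 NOT discharged; COUNT of record unmoved · K
numerically unchanged; one finite `𝕋⁴` programme at fixed `ε`, Bałaban AS PRINTED; nothing continuum ∕ ℝ⁴ ∕ OS ∕ mass-gap ∕ Clay.  No `sorry`, no `def`.

[cite: Balaban1985RegularSpaces, Prop. 5 (1.107)–(1.109) p.94, (1.92) p.91, (1.95)–(1.106) pp.92–94, (1.112)–(1.121) pp.95–97, (1.78)–(1.79) p.90, (1.29) p.81, p.93;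
Balaban1985Averaging, Proposition 10 (203)–(214) p.50, (166)–(167) p.44, (178) p.45; Balaban1985BackgroundPropagators, Theorem 3.1 p.397, (3.19)–(3.25) pp.393–394;
Balaban1987RG1, (0.3)–(0.4) pp.252–253]
-/

noncomputable section

open NormedSpace Metric Set Filter Topology
open Complex (I)

namespace Literature.MathematicalPhysics.QuantumFieldTheory.Balaban1983to89.B8Prop5JoinSectELocalRDRec

open B7Prop1Explicit (e U1 expUnit val_inv_expUnit)
open B7Prop2Explicit (unitaryUnits mem_unitaryUnits unitaryUnits_le_U1 c2')
open B7Prop2Rec (AvgClosedZ C0Z avgClosedZ_unitaryUnits)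
open B7Prop4GeneralLevelsRec (cZ KZ gZ_nonneg)
open B7Prop1Local (InBox pdevOn)
open B7Prop3Flat (expCfg c3)
open B7Eq78Linearization (conjR QprimeIter QprimeIter_smul)
open B7Eq170Flat (cj cj_apply)
open B7Prop10General (C6 C4G)
open B7Prop10Flat (one_le_C5 C4'_nonneg C5'_nonneg)
open B7Prop9Flat (C5')
open B7Eq214General (Cgen)
open B8Ineq130Rec (tlo thi)
open B7SectCDGaugeAveragesRec (glevZ)
open B7SectEFLinearisationRec (zdBlockingZ bgTZ InLambdaZ)
open B7Eq92Concrete (mgauge)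
open B8Eq119TwistedAxialRec (InAxZ Restr129Z)
open B8Eq178AveragesRec (util178Z QnlZ Cond179Z)
open B8Eq1123Concrete (cj_smul_complex)
open B8Eq1123ConcreteRec (CnlZ)
open B8Ineq125Concrete (C2p C2p_nonneg)
open B8Eq1117Concrete (XSpace)
open B8Eq1117KLevel (dom120_of_119_tower)
open B8DprimeKLevelLipschitz (smallness_prod)
open B8SectEKLevelInLambdaRec (exists_Dprime_kLevel_inv_of_axial Dprime_lipschitz_kLevel_inv_of_axial)
open B8Ineq132 (covDerivFwd covDeriv norm_conjR)
open B8Eq151V2Divergence (eta_smul_covDerivFwd covDerivFwd_smul)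
open B8Eq146AExpansion (covDeriv_smul)
open B8Eq138LandauZd (covLap covDivB)
open B8Eq138LandauZdRec (QTZ)
open B8Eq182Proof (gAd)
open B8Eq184Proof (gaugeExp)
open B8Eq188Proof (frakF3)
open B8LambdaSpaceKLevel (wt wt_pos wt_nonneg lamSubK lamOf lamOf_sub norm_lamOf_le weight_mul_norm_covDerivFwd_le norm_cjDiff_lamOf_le
  norm_le_iff norm_sub_le_iff covDerivFwd_sub')
open B8Prop5JoinHFP (covLap_neg')
open B8Prop5ContractionKLevel (Bd2 Mc Kc)
open B8Prop5KLevelLetters (covLap_sub)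
open B8Prop5JoinSectE (cjDiff_le_of_weighted covLap_smul)
open B8Prop5JoinSectERec (exists_Dprime_map)

-- `Site` alone could resolve to the torus sites of `Setup.lean`; re-export the `ℤ^d` sites of `B7Prop1Explicit`.
export B7Prop1Explicit (Site)

variable {d : ℕ} {𝔸 : Type*} [CStarAlgebra 𝔸] [Nontrivial 𝔸]

omit [Nontrivial 𝔸] in
/-- The record's gauge-fixing witness constant `20dKZ·c` is non-negative (`KZ = 2(1 + 2g_Z) ≥ 0`). [folklore] -/
private theorem alpha3Z_nonneg (L : ℕ) {c : ℝ} (hc : 0 ≤ c) : 0 ≤ 20 * (d : ℝ) * KZ d L * c := by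
  have hK : 0 ≤ KZ d L := by unfold KZ; have := gZ_nonneg d L; positivity
  positivity

/-! ## §0 File-local scalar bookkeeping -/

section Bookkeeping

omit [Nontrivial 𝔸] in
/-- `‖(−i)·a‖ = ‖a‖`. [folklore] -/
private theorem norm_negI_smul (a : 𝔸) : ‖(-I) • a‖ = ‖a‖ := by
  rw [norm_smul, norm_neg, Complex.norm_I, one_mul]

omit [Nontrivial 𝔸] in
/-- `i·((−i)·a) = a` and `(−i)·(i·a) = a`. [folklore] -/
private theorem I_smul_negI_smul (a : 𝔸) : I • ((-I) • a) = a ∧ (-I) • (I • a) = a := by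
  constructor <;> rw [smul_smul] <;> simp [Complex.I_mul_I]

omit [Nontrivial 𝔸] in
/-- `((−i)·a)* = i·a*` in a C⋆-algebra. [folklore] -/
private theorem star_negI_smul (a : 𝔸) : star ((-I) • a) = I • star a := by
  rw [star_smul, star_neg, Complex.star_def, Complex.conj_I, neg_neg]

omit [Nontrivial 𝔸] in
/-- `(−i)·a` is Hermitian when `a* = −a`. [folklore] -/
private theorem isSelfAdjoint_negI_smul_of_skew {a : 𝔸} (ha : star a = -a) : IsSelfAdjoint ((-I) • a) := by
  rw [IsSelfAdjoint, star_negI_smul, ha, smul_neg, ← neg_smul]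

omit [Nontrivial 𝔸] in
/-- `((−i)·a)* = −((−i)·a)` when `a` is Hermitian: `−iλ` is skew for Hermitian `λ`. [folklore] -/
private theorem star_negI_smul_of_sa {a : 𝔸} (ha : IsSelfAdjoint a) : star ((-I) • a) = -((-I) • a) := by
  rw [star_negI_smul, ha.star_eq, neg_smul, neg_neg]

end Bookkeeping


/-! ## §1 JOIN-B with the local inversion route, inverse laws on print's domains (cf. `B8Prop5JoinSectELocal` §1: (1.29) for `u₁·e^{iλ′}` with `pub-ymgap-dag-n04-b`'s
tower-local `B8Restr129InversionLocal` (no global (167), no `hdom`, no `Restr129 … u₁⁻¹`) -/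

section Local

open B7Prop1Local (clampCfg)
open B8Eq1117KLevelRec (glevZ_on_towers_of_axial)
open B8SectEInLambdaWitnessRec (witness_unitary_of_glevZ)
open B8Restr129InversionLocalRec (restr129_mul_inv_of_cond179_local)
open B8Prop5GaugeParamKLevel (gaugeParam_kLevel gpar_size)
open B8Prop5ContractionKLevel (Zsol Vop Wsrc PsiP5)
open B8Prop5KLevelLettersRec (multiplier_iff_of_whyZ)
open B8Eq195Linear (proj325_sub)
open B8Eq195LinearRange (q_g_proj325_range)
open B8Prop5JoinSectERec (restr129_mul_gaugeExp_local)
open B8Eq188Proof (gAd_neg)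
open B8Prop5JoinHFP (covLap_neg')

variable {L sL k : ℕ} {η : ℝ} {Ω Λs : ℕ → Set (Site d)} {Eb : ℕ → Set (Site d × Fin d)} {U₀ : Site d → Fin d → 𝔸ˣ}
  {A : Site d → Fin d → 𝔸} {u₁ : Site d → 𝔸ˣ}

/-- **JOIN-B WITH THE LOCAL INVERSION ROUTE, [4]'s INVERSE LAWS ON PRINT'S DOMAINS** — `B8Prop5JoinSectELocal.hFP_kLevel_of179_local` VERBATIM except: NO
left-inverse law of `G′` (unused); the right-inverse law POINTWISE ON `Ω₀`, `g_rightΩ : ∀ x, ∀ y ∈ Ω₀, (Δ(G′x) + Q′ᵀ𝔄Q′(G′x))(y) = x(y)` ([4] Thm 3.1: `G′` inverts the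
Dirichlet operator on functions on the region; dag-ref-A W8′); the law of `C` in range form `c_range` ((3.25); W8).  «Q′λ_s = 0» by `q_g_proj325_range`; «ΔG′R = R» and
the multiplier identity read at sites of `Ω₀`.  As there: `B8Prop5JoinHFP.hFP_kLevel_of179` re-run with its GLOBAL [3]-inputs for the inverse pair (`hdom`,
`h167`, `Restr129 … u₁⁻¹`, the `β`-window; n04-b's LOCATED-2) REPLACED by the tower-local route `restr129_mul_gaugeExp_local`: the contraction
(JOIN-A `gaugeParam_kLevel`), the projection laws (`Q′λ = 0`, `Δλ = R(−Z)`), the multiplier form via `multiplier_iff_of_whyZ` — verbatim — and the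
(1.29)-clause from «`Q′(u₁⁻¹, e^{−iλ′}) = 0`» (`h179E`, Sect. E's (1.114) in its printed use, for the abstract `H_c`) by the local lemma.  `H_c` is
still a LETTER here (eight binders); §2 instantiates it. [cite: Balaban1985RegularSpaces, Prop. 5 (1.107)–(1.109) p.94, (1.95)–(1.106) pp.92–94,
(1.113)–(1.114) p.95, (1.78)–(1.79) p.90, (1.29) p.81] -/
theorem hFP_kLevel_of179_local_RD (hLs : L = 2 * sL + 1) (hs1 : 1 ≤ sL) (hη : 0 < η) (hd : 1 ≤ d) (hU₀ : ∀ x κ, U₀ x κ ∈ unitaryUnits 𝔸)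
    (hEbΩ : ∀ j, j ≤ k → ∀ x ∈ Ω j, ∀ μ : Fin d, (x, μ) ∈ Eb j ∧ (x - e μ, μ) ∈ Eb j)
    (hEbT : ∀ j, j ≤ k → ∀ y ∈ Λs j, ∀ (x : Site d) (κ : Fin d), InBox (tlo L y j) (thi L y j) x →
      InBox (tlo L y j) (thi L y j) (x + e κ) → (x, κ) ∈ Eb j)
    -- letters of [4]
    (g Δ : (Site d → 𝔸) →ₗ[ℂ] (Site d → 𝔸)) (q : (Site d → 𝔸) →ₗ[ℂ] (ℕ → Site d → 𝔸)) (qs : (ℕ → Site d → 𝔸) →ₗ[ℂ] (Site d → 𝔸))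
    (Aw c : (ℕ → Site d → 𝔸) →ₗ[ℂ] (ℕ → Site d → 𝔸))
    (g_rightΩ : ∀ x, ∀ y ∈ Ω 0, (Δ (g x) + qs (Aw (q (g x)))) y = x y)
    (c_range : ∀ f, q (g (g (qs (c (q f))))) = q f)
    (hΔ : ∀ (f : Site d → 𝔸), ∀ x ∈ Ω 0, Δ f x = covLap η U₀ ((Ω 0).indicator f) x)
    (hqs : ∀ (μ : ℕ → Site d → 𝔸), ∀ x ∈ Ω 0, qs μ x = QTZ L k Λs U₀ μ x)
    (Hc : (Site d → 𝔸) → (Site d → 𝔸))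
    -- the tower-local regime of the inversion route (datum AT u₁)
    {B : Site d → Fin d → 𝔸} {α₀ αP cB : ℝ}
    (hα : 0 < α₀) (hα3 : C0Z d * α₀ ≤ 1 / 3) (hα4 : 4 * α₀ ≤ c2' d L) (hcB : 0 ≤ cB)
    (hαP : 0 < αP) (hαP3 : C0Z d * αP ≤ 1 / 3) (hαP2 : 2 * αP ≤ c2' d L)
    (hBu : ∀ (x : Site d) (κ : Fin d), expCfg B x κ ∈ unitaryUnits 𝔸)
    (h33 : ∀ j, j ≤ k → ∀ y ∈ Λs j, pdevOn (tlo L y j) (thi L y j) U₀ < α₀ * (((L : ℝ) ^ j)⁻¹) ^ 2)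
    (h69 : ∀ j, j ≤ k → ∀ y ∈ Λs j, ∀ (x : Site d) (κ : Fin d), InBox (tlo L y j) (thi L y j) x →
      InBox (tlo L y j) (thi L y j) (x + e κ) → ‖B x κ‖ ≤ cB * ((L : ℝ) ^ j)⁻¹)
    (hP : ∀ j, j ≤ k → ∀ y ∈ Λs j, pdevOn (tlo L y j) (thi L y j) (expCfg B * U₀) < αP * (((L : ℝ) ^ j)⁻¹) ^ 2)
    (hAx : InAxZ L k Λs U₀ (mgauge U₀ u₁ (expCfg B) * U₀)) (h129 : Restr129Z L k Λs U₀ u₁)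
    (hsmall : Real.exp (4 * cZ d * α₀) * (1 + 2 * (131072 * ((d : ℝ) + 1) ^ 2) * (KZ d L) ^ 2 * cB) ≤ 2)
    (hc₃ : KZ d L * cB ≤ c3 d L) (hsc : 1024 * (d : ℝ) * KZ d L * cB ≤ 1) (hα₃' : 20 * d * KZ d L * cB ≤ 1 / 200)
    {α₄ BG BR h₀ h₁ h₂ l₀ l₁ l₂ cA cDA : ℝ}
    (hw₁ : 10 * C6 d * (4 * (2 * α₄)) ≤ 1) (hw₂ : 3000 * ((d : ℝ) + 1) * L * (4 * (2 * α₄)) ≤ 1)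
    (hw₃ : C4G d L * (α₀ + 20 * d * KZ d L * cB + 4 * (2 * α₄)) ≤ 1)
    (hw₄ : 1024 * ((d : ℝ) + 1) * ((d : ℝ) + 4) * L ^ 2 * α₀ ≤ 1) (hw₅ : 32 * ((d : ℝ) + 1) ^ 2 * C6 d * L ^ 2 * α₀ ≤ 1)
    (hw₆ : 16 * d * C5' d * C6 d * (L : ℝ) ^ 2 * α₀ ≤ 1) (hprod : 2 * C6 d * (20 * d * KZ d L * cB + 4 * (2 * α₄)) < 1 / 2)
    -- JOIN-B's windows, letters G′/R, H_c's eight binders, the datum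
    (hα₄ : 0 < α₄) (hBG : 0 ≤ BG) (hBR : 0 ≤ BR) (hh₀ : 0 ≤ h₀) (hh₂ : 0 ≤ h₂) (hl₀ : 0 ≤ l₀) (hl₁ : 0 ≤ l₁)
    (hl₂ : 0 ≤ l₂) (hcA : 0 ≤ cA) (hcA' : cA ≤ 1 / 13) (hcDA : 0 ≤ cDA)
    (ha₁' : α₄ / 4 + h₀ ≤ 1 / 24) (hb₁' : α₄ / 4 + h₁ ≤ 1 / 140) (hb₁ : 0 < α₄ / 4 + h₁) (hθ : 10 * (α₄ / 4 + h₀) * BR ≤ 1 / 2)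
    (hh₀' : h₀ ≤ 3 * α₄ / 4) (hh₁' : h₁ ≤ 3 * α₄ / 4)
    (hG : ∀ (f : Site d → 𝔸) (m : ℝ), 0 ≤ m → Bd2 L η k Ω f m →
      (∀ x, ‖g f x‖ ≤ BG * m) ∧ ∀ j, j ≤ k → ∀ p ∈ Eb j, wt L η j * ‖covDerivFwd η U₀ p.2 (g f) p.1‖ ≤ BG * m)
    (hGsupp : ∀ (f : Site d → 𝔸) (x : Site d), x ∉ Ω 0 → g f x = 0)
    (hGreal : ∀ f : Site d → 𝔸, (∀ j, j ≤ k → ∀ x ∈ Ω j, IsSelfAdjoint (f x)) → ∀ x, IsSelfAdjoint (g f x))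
    (hRbd : ∀ (f : Site d → 𝔸) (m : ℝ), 0 ≤ m → Bd2 L η k Ω f m → Bd2 L η k Ω (f - g (qs (c (q (g f))))) (BR * m))
    (hRreal : ∀ f : Site d → 𝔸, (∀ j, j ≤ k → ∀ x ∈ Ω j, IsSelfAdjoint (f x)) →
      ∀ j, j ≤ k → ∀ x ∈ Ω j, IsSelfAdjoint ((f - g (qs (c (q (g f))))) x))
    (hc0 : ∀ s : lamSubK η U₀ L k Eb, ‖s‖ ≤ α₄ / 4 → ∀ x, ‖Hc (lamOf s) x‖ ≤ h₀)
    (hc1 : ∀ s : lamSubK η U₀ L k Eb, ‖s‖ ≤ α₄ / 4 → ∀ j, j ≤ k → ∀ p ∈ Eb j, wt L η j * ‖covDerivFwd η U₀ p.2 (Hc (lamOf s)) p.1‖ ≤ h₁)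
    (hc2 : ∀ s : lamSubK η U₀ L k Eb, ‖s‖ ≤ α₄ / 4 → Bd2 L η k Ω (covLap η U₀ (Hc (lamOf s))) h₂)
    (hcL0 : ∀ s t : lamSubK η U₀ L k Eb, ‖s‖ ≤ α₄ / 4 → ‖t‖ ≤ α₄ / 4 → ∀ x, ‖Hc (lamOf s) x - Hc (lamOf t) x‖ ≤ l₀ * ‖s - t‖)
    (hcL1 : ∀ s t : lamSubK η U₀ L k Eb, ‖s‖ ≤ α₄ / 4 → ‖t‖ ≤ α₄ / 4 → ∀ j, j ≤ k → ∀ p ∈ Eb j,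
      wt L η j * ‖covDerivFwd η U₀ p.2 (Hc (lamOf s) - Hc (lamOf t)) p.1‖ ≤ l₁ * ‖s - t‖)
    (hcL2 : ∀ s t : lamSubK η U₀ L k Eb, ‖s‖ ≤ α₄ / 4 → ‖t‖ ≤ α₄ / 4 →
      Bd2 L η k Ω (covLap η U₀ (Hc (lamOf s)) - covLap η U₀ (Hc (lamOf t))) (l₂ * ‖s - t‖))
    (hcsa : ∀ s : lamSubK η U₀ L k Eb, ‖s‖ ≤ α₄ / 4 → (∀ x, IsSelfAdjoint (lamOf s x)) → ∀ x, IsSelfAdjoint (Hc (lamOf s) x))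
    (hcsupp : ∀ s : lamSubK η U₀ L k Eb, ‖s‖ ≤ α₄ / 4 → ∀ x, x ∉ Ω 0 → Hc (lamOf s) x = 0)
    (hDA : Bd2 L η k Ω (fun y => covDivB η U₀ A y) cDA) (hDAsa : ∀ j, j ≤ k → ∀ x ∈ Ω j, IsSelfAdjoint (covDivB η U₀ A x))
    (hA : ∀ j, j ≤ k → ∀ x ∈ Ω j, ∀ μ : Fin d,
      wt L η j * ‖A x μ‖ ≤ cA ∧ wt L η j * ‖conjR (U₀ (x - e μ) μ)⁻¹ (A (x - e μ) μ)‖ ≤ cA)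
    (hAsa : ∀ x μ, IsSelfAdjoint (A x μ))
    (h103 : BG * Mc d BR (α₄ / 4 + h₁) cA h₂ cDA ≤ α₄ / 4)
    (h106 : BG * Kc d BR (α₄ / 4 + h₁) cA h₂ cDA l₂ (1 + l₀) (1 + l₁) ≤ 1 / 2)
    -- Sect. E's (1.114) in its printed use, for the inverse pair, at the abstract H_c
    (h179E : ∀ s : lamSubK η U₀ L k Eb, ‖s‖ ≤ α₄ / 4 → q (lamOf s) = 0 →
      Cond179Z L k Λs U₀ (fun x => expUnit (((-I) • (lamOf s + Hc (lamOf s))) x)) u₁⁻¹) :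
    ∃ lam : Site d → 𝔸, (∀ x, IsSelfAdjoint (lam x)) ∧ (∀ x, x ∉ Ω 0 → lam x = 0) ∧
      (∀ j, j ≤ k → ∀ p ∈ Eb j, ‖lam p.1‖ ≤ α₄ ∧ wt L η j * ‖covDerivFwd η U₀ p.2 lam p.1‖ ≤ α₄) ∧
      (∃ μ : ℕ → Site d → 𝔸, ∀ x ∈ Ω 0,
        covLap η U₀ ((Ω 0).indicator fun y => covDivB η U₀ A y + covLap η U₀ lam y +
          ((conjR (gaugeExp lam y)⁻¹ (covDivB η U₀ A y) - covDivB η U₀ A y) +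
            (gAd (covLap η U₀ lam y) (lam y) - covLap η U₀ lam y) + ∑ μ, frakF3 η U₀ lam A y μ)) x = QTZ L k Λs U₀ μ x) ∧
      Restr129Z L k Λs U₀ (u₁ * gaugeExp lam) := by
  have hL1 : 1 ≤ L := by omega
  -- the letter R of (1.95)
  set R : (Site d → 𝔸) → (Site d → 𝔸) := fun f => f - g (qs (c (q (g f)))) with hRdef
  have hR : ∀ f, R f = f - g (qs (c (q (g f)))) := fun f => rfl
  have hRsub : ∀ f f' : Site d → 𝔸, R (f - f') = R f - R f' := proj325_sub (R := R) hR
  have hR0 : R 0 = 0 := by rw [hR]; simp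
  have hRneg : ∀ f : Site d → 𝔸, R (-f) = -R f := fun f => by rw [← zero_sub, hRsub, hR0, zero_sub]
  -- JOIN-A
  obtain ⟨s, s', hs, hfix, hs', hn', hsa', hoff', hN⟩ := gaugeParam_kLevel (Ω := Ω) (Eb := Eb) (U₀ := U₀) (A := A)
    (DA := fun y => covDivB η U₀ A y) hL1 hη hU₀ hEbΩ (⇑g) R Hc hα₄.le hBG hBR hh₀ hh₂ hl₀ hl₁ hl₂ hcA hcA' hcDA ha₁' hb₁' hb₁ hθ hh₀'
    hh₁' hG (fun f f' => map_sub g f f') hGsupp hGreal hRsub hRbd hRreal hc0 hc1 hc2 hcL0 hcL1 hcL2 hcsa hcsupp hDA hDAsa hA hAsa h103 h106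
  set lam' := lamOf s' with hlam'def
  have hgp : lamOf s + Hc (lamOf s) = lam' := hs'.symm
  -- the Neumann solution at λ′
  set Z : Site d → 𝔸 := Zsol (Wsrc η U₀ A (fun y => covDivB η U₀ A y) lam' (covLap η U₀ (Hc (lamOf s)))) (Vop lam') R with hZdef
  -- the fixed point read through the projection laws: Q′λ = 0 and Δλ = R(−Z)
  have hfix' : lamOf s = g (R (fun x => -Z x)) := by
    have h := hfix
    simp only [PsiP5] at h
    rw [hgp] at h
    exact h
  have hfix'' : lamOf s = g (R (-Z)) := hfix'
  have hqR : q (g (R (-Z))) = 0 := q_g_proj325_range (R := R) hR c_range (-Z)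
  have hq : q (lamOf s) = 0 := by rw [hfix'']; exact hqR
  -- «ΔG′R = R» read POINTWISE on Ω₀ (the right-inverse law of G′ on print's domain)
  have hΔs : ∀ y ∈ Ω 0, Δ (lamOf s) y = R (-Z) y := fun y hy => by
    have h1 := g_rightΩ (R (-Z)) y hy
    rw [hqR, map_zero, map_zero, add_zero] at h1
    rw [hfix'']
    exact h1
  -- sizes at λ′ on Ω₀
  have hl : ∀ y ∈ Ω 0, ‖lam' y‖ ≤ 1 / 12 := fun y _ => by
    rw [← hgp]; exact (gpar_size hc0 s hs y).trans (ha₁'.trans (by norm_num))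
  -- support of λ_s (Dirichlet range of G′)
  have hoff : ∀ x, x ∉ Ω 0 → lamOf s x = 0 := fun x hx => by rw [hfix'']; exact hGsupp _ x hx
  have hind : (Ω 0).indicator (lamOf s) = lamOf s := by
    funext x
    by_cases hx : x ∈ Ω 0
    · rw [Set.indicator_of_mem hx]
    · rw [Set.indicator_of_notMem hx, hoff x hx]
  refine ⟨lam', hsa', hoff', fun j hj p hp => ?_, ?_, ?_⟩
  · -- (1.108)
    have h := (norm_le_iff hη.le s' hα₄.le).1 hn'
    exact ⟨h.1 p.1, h.2 j hj p hp⟩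
  · -- the multiplier clause, via n04-b's WHY-Z bridge
    have hdef : lam' = lamOf s - (-Hc (lamOf s)) := by rw [sub_neg_eq_add, hgp]
    have hNy : ∀ y ∈ Ω 0, Z y + (gAd (R Z y) (lam' y) - R Z y) =
        conjR (gaugeExp lam' y)⁻¹ (covDivB η U₀ A y) - gAd (covLap η U₀ (-Hc (lamOf s)) y) (lam' y) + ∑ μ, frakF3 η U₀ lam' A y μ := by
      intro y hy
      have h := hN 0 (Nat.zero_le _) y hy
      simp only [Vop, Wsrc] at h
      rw [h, covLap_neg', gAd_neg _ (hl y hy), sub_neg_eq_add]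
    have hΔy : ∀ y ∈ Ω 0, covLap η U₀ (lamOf s) y = -R Z y := by
      intro y hy
      rw [← hind, ← hΔ _ y hy, hΔs y hy, hRneg, Pi.neg_apply]
    refine (multiplier_iff_of_whyZ L k (Ω 0) Λs U₀ A hdef hl hNy hΔy).2 ?_
    set φ := c (q (g Z)) with hφ
    refine ⟨φ - Aw (q (g (qs φ))), fun x hx => ?_⟩
    have hZR : Z - R Z = g (qs φ) := by rw [hR]; abel
    -- «ΔG′Q′ᵀφ = Q′ᵀ(φ − 𝔄Q′G′Q′ᵀφ)» read POINTWISE on Ω₀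
    have hlap : Δ (g (qs φ)) x = qs (φ - Aw (q (g (qs φ)))) x := by
      rw [map_sub, Pi.sub_apply]
      exact eq_sub_of_add_eq (by rw [← Pi.add_apply]; exact g_rightΩ (qs φ) x hx)
    rw [← hΔ _ x hx, hZR, hlap, hqs _ x hx]
  · -- (1.29) for u₁·e^{iλ′} by the LOCAL inversion route
    rw [← hgp]
    exact restr129_mul_gaugeExp_local hLs hs1 hη hd hU₀ hEbT hα hα3 hα4 hcB hα₄ hαP hαP3 hαP2 hBu h33 h69 hP hAx h129 hsmall hc₃ hsc hα₃' hw₁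
      hw₂ hw₃ hw₄ hw₅ hw₆ hprod Hc hh₀' hh₁' hc0 hc1 s hs (h179E s hs hq)


end Local


/-! ## §2 JOIN-C with the local inversion route, inverse laws on print's domains: no global [3]-input, nothing at `u₁⁻¹` -/

section JoinLocal

open B8Prop5JoinSectERec (cond179_of_eq114')

variable {L sL k : ℕ} {η : ℝ} {Ω Λs : ℕ → Set (Site d)} {Eb : ℕ → Set (Site d × Fin d)} {U₀ : Site d → Fin d → 𝔸ˣ}
  {A : Site d → Fin d → 𝔸} {u₁ : Site d → 𝔸ˣ}

/-- **JOIN-C WITH THE LOCAL INVERSION ROUTE, [4]'s INVERSE LAWS ON PRINT'S DOMAINS — PROPOSITION 5'S FIXED POINT IN THE KNIT'S CURRENCY, NO GLOBAL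
[3]-INPUT, NOTHING AT `u₁⁻¹`.**  `B8Prop5JoinSectELocal.hFP_kLevel_of_sectE_local` VERBATIM except: no `g_left`; `g_rightΩ` (right inverse pointwise on `Ω₀`,
[4] Thm 3.1; W8′) and `c_range` ((3.25); W8) in place of the total laws.  As there:  `hFP_kLevel_of_sectE` with JOIN-B's inversion inputs `hdom`/`h167`/`Restr129 … u₁⁻¹`/`β`-window (n04-b LOCATED-2: over-strong GLOBAL
(167) binders) REPLACED by n04-b's tower-local `B8Restr129InversionLocal.restr129_mul_inv_of_cond179_local` (via `hFP_kLevel_of179_local`):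
the only new window is r04's product condition `2C₆(40d·c_B + 8α₄) < ½` (`hprod`); the Prop-10 windows at `8α₄` follow from the Sect. E
windows at `2α₄`.  `H_c λ := −i·H′D′(u₁⁻¹, −iλ)` as in `hFP_kLevel_of_sectE` (sizes `hE hE₂ lE lE₂`, reality by uniqueness, support by
`H′`'s range).  DISPLAYED: the [4] letters `g Δ q qs Aw c` + `H′` with laws/bounds/covariance (`hq`, `hH0`–`hH2`, `hHsupp`, `hHequiv`, `hQH`),
[3]'s remainder covariance `hCequiv`, the datum's tower-local regime AT `u₁` ((1.33) `h33`, (1.69) `h69`, `hBu`, `hP`, (1.34) `InAx`, (1.29)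
`Restr129 u₁`, windows), tower bonds in `Eb j` (`hEbT`), (1.101)/(1.98)R/range/reality of `G′`, `R`, the datum, JOIN-B's windows at the
Sect. E sizes.  CONCLUSION: verbatim JOIN-B's (`λ′` Hermitian, `= 0` off `Ω₀`, (1.108), multiplier form on `Ω₀`, (1.29) for `u₁·e^{iλ′}`).
[cite: Balaban1985RegularSpaces, Prop. 5 (1.107)–(1.109) p.94, (1.92) p.91, (1.95)–(1.106) pp.92–94, (1.113)–(1.121) pp.95–97, (1.78)–(1.79)
p.90, (1.29) p.81; Balaban1985Averaging, Prop. 10 (203)–(204) p.50, (213)–(214) p.50] -/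
theorem hFP_kLevel_of_sectE_local_RD (hLs : L = 2 * sL + 1) (hs1 : 1 ≤ sL) (hη : 0 < η) (hU₀ : ∀ x κ, U₀ x κ ∈ unitaryUnits 𝔸)
    (hEbΩ : ∀ j, j ≤ k → ∀ x ∈ Ω j, ∀ μ : Fin d, (x, μ) ∈ Eb j ∧ (x - e μ, μ) ∈ Eb j)
    (hEbT : ∀ j, j ≤ k → ∀ y ∈ Λs j, ∀ (x : Site d) (κ : Fin d), InBox (tlo L y j) (thi L y j) x →
      InBox (tlo L y j) (thi L y j) (x + e κ) → (x, κ) ∈ Eb j)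
    -- letters of [4]
    (g Δ : (Site d → 𝔸) →ₗ[ℂ] (Site d → 𝔸)) (q : (Site d → 𝔸) →ₗ[ℂ] (ℕ → Site d → 𝔸)) (qs : (ℕ → Site d → 𝔸) →ₗ[ℂ] (Site d → 𝔸))
    (Aw c : (ℕ → Site d → 𝔸) →ₗ[ℂ] (ℕ → Site d → 𝔸))
    (g_rightΩ : ∀ x, ∀ y ∈ Ω 0, (Δ (g x) + qs (Aw (q (g x)))) y = x y)
    (c_range : ∀ f, q (g (g (qs (c (q f))))) = q f)
    (hΔ : ∀ (f : Site d → 𝔸), ∀ x ∈ Ω 0, Δ f x = covLap η U₀ ((Ω 0).indicator f) x)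
    (hqs : ∀ (μ : ℕ → Site d → 𝔸), ∀ x ∈ Ω 0, qs μ x = QTZ L k Λs U₀ μ x)
    (hq : ∀ (f : Site d → 𝔸) (j : ℕ), j ≤ k → ∀ y ∈ Λs j, q f j y = QprimeIter (zdBlockingZ d L) (bgTZ L U₀) j f y)
    -- the letter H′ of [4] ((1.92)) and the Sect. E / local-inversion regime (tower-local, everything AT u₁)
    (H' : XSpace d k 𝔸 →ₗ[ℂ] (Site d → 𝔸)) {B : Site d → Fin d → 𝔸} {α₀ αP α₄ cB B₀' B₂' : ℝ}
    (hα : 0 < α₀) (hα3 : C0Z d * α₀ ≤ 1 / 3) (hα4 : 4 * α₀ ≤ c2' d L) (hcB : 0 ≤ cB) (hα₄ : 0 < α₄) (hB : 0 < B₀') (hB₂ : 0 ≤ B₂')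
    (h33 : ∀ j, j ≤ k → ∀ y ∈ Λs j, pdevOn (tlo L y j) (thi L y j) U₀ < α₀ * (((L : ℝ) ^ j)⁻¹) ^ 2)
    (h69 : ∀ j, j ≤ k → ∀ y ∈ Λs j, ∀ (x : Site d) (κ : Fin d), InBox (tlo L y j) (thi L y j) x →
      InBox (tlo L y j) (thi L y j) (x + e κ) → ‖B x κ‖ ≤ cB * ((L : ℝ) ^ j)⁻¹)
    (hd : 1 ≤ d) (hαP : 0 < αP) (hαP3 : C0Z d * αP ≤ 1 / 3) (hαP2 : 2 * αP ≤ c2' d L)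
    (hBu : ∀ (x : Site d) (κ : Fin d), expCfg B x κ ∈ unitaryUnits 𝔸)
    (hP : ∀ j, j ≤ k → ∀ y ∈ Λs j, pdevOn (tlo L y j) (thi L y j) (expCfg B * U₀) < αP * (((L : ℝ) ^ j)⁻¹) ^ 2)
    (hAx : InAxZ L k Λs U₀ (mgauge U₀ u₁ (expCfg B) * U₀)) (h129 : Restr129Z L k Λs U₀ u₁)
    (hH0 : ∀ (X : XSpace d k 𝔸) (x : Site d), ‖H' X x‖ ≤ B₀' * ‖X‖)
    (hH1 : ∀ j, j ≤ k → ∀ (X : XSpace d k 𝔸), ∀ p ∈ Eb j, wt L η j * ‖covDerivFwd η U₀ p.2 (H' X) p.1‖ ≤ B₀' * ‖X‖)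
    (hH2 : ∀ X : XSpace d k 𝔸, Bd2 L η k Ω (covLap η U₀ (H' X)) (B₂' * ‖X‖))
    (hHsupp : ∀ (X : XSpace d k 𝔸) (x : Site d), x ∉ Ω 0 → H' X x = 0)
    (hHequiv : ∀ X Y : XSpace d k 𝔸, (∀ p, Y p = -star (X p)) → ∀ x, H' Y x = -star (H' X x))
    (hQH : ∀ (Y : XSpace d k 𝔸) (j : ℕ) (hj : j ≤ k) (y : Site d), y ∈ Λs j →
      QprimeIter (zdBlockingZ d L) (bgTZ L U₀) j (H' Y) y = Y (⟨j, Nat.lt_succ_of_le hj⟩, y))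
    (hCequiv : ∀ j, j ≤ k → ∀ y ∈ Λs j, ∀ μ : Site d → 𝔸,
      (∀ x : Site d, InBox (tlo L y j) (thi L y j) x → ‖μ x‖ < α₄) →
      (∀ (x : Site d) (κ : Fin d), InBox (tlo L y j) (thi L y j) x → InBox (tlo L y j) (thi L y j) (x + e κ) →
        ‖cj (U₀ x κ) (μ (x + e κ)) - μ x‖ < α₄ * ((L : ℝ) ^ j)⁻¹) →
      CnlZ L U₀ u₁⁻¹ j (fun x => -star (μ x)) y = -star (CnlZ L U₀ u₁⁻¹ j μ y))
    (hsmall : Real.exp (4 * cZ d * α₀) * (1 + 2 * (131072 * ((d : ℝ) + 1) ^ 2) * (KZ d L) ^ 2 * cB) ≤ 2)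
    (hc₃ : KZ d L * cB ≤ c3 d L) (hsc : 1024 * (d : ℝ) * KZ d L * cB ≤ 1) (hα₃' : 20 * d * KZ d L * cB ≤ 1 / 200)
    (hs₁ : 200 * C6 d * (2 * α₄) ≤ 1) (hs₂ : 12000 * ((d : ℝ) + 1) * L * (2 * α₄) ≤ 1)
    (hs₃ : C4G d L * (α₀ + 20 * d * KZ d L * cB + 4 * (2 * α₄)) ≤ 1)
    (hs₄ : 1024 * ((d : ℝ) + 1) * ((d : ℝ) + 4) * L ^ 2 * α₀ ≤ 1) (hs₅ : 32 * ((d : ℝ) + 1) ^ 2 * C6 d * L ^ 2 * α₀ ≤ 1)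
    (hs₆ : 16 * d * C5' d * C6 d * (L : ℝ) ^ 2 * α₀ ≤ 1) (hs₇ : 8 * d * C6 d * L * α₀ ≤ 1)
    (hsm : 20 * d * KZ d L * cB + α₄ ≤ 1 / (4 * B₀' * (2 * C2p d))) (hprod : 2 * C6 d * (20 * d * KZ d L * cB + 4 * (2 * α₄)) < 1 / 2)
    -- the Sect. E sizes of H_c (named, so that the windows below read)
    {hE hE₂ lE lE₂ : ℝ} (hE_def : hE = B₀' * (C2p d * (20 * d * KZ d L * cB + α₄) * α₄)) (hE₂_def : hE₂ = B₂' * (C2p d * (20 * d * KZ d L * cB + α₄) * α₄))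
    (lE_def : lE = B₀' * (4 * C2p d * (20 * d * KZ d L * cB + 2 * α₄))) (lE₂_def : lE₂ = B₂' * (4 * C2p d * (20 * d * KZ d L * cB + 2 * α₄)))
    -- JOIN-B's letters G′, R, the datum, and its windows at these sizes
    {BG BR cA cDA : ℝ} (hBG : 0 ≤ BG) (hBR : 0 ≤ BR) (hcA : 0 ≤ cA) (hcA' : cA ≤ 1 / 13) (hcDA : 0 ≤ cDA)
    (ha₁' : α₄ / 4 + hE ≤ 1 / 24) (hb₁' : α₄ / 4 + hE ≤ 1 / 140) (hθ : 10 * (α₄ / 4 + hE) * BR ≤ 1 / 2)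
    (hG : ∀ (f : Site d → 𝔸) (m : ℝ), 0 ≤ m → Bd2 L η k Ω f m →
      (∀ x, ‖g f x‖ ≤ BG * m) ∧ ∀ j, j ≤ k → ∀ p ∈ Eb j, wt L η j * ‖covDerivFwd η U₀ p.2 (g f) p.1‖ ≤ BG * m)
    (hGsupp : ∀ (f : Site d → 𝔸) (x : Site d), x ∉ Ω 0 → g f x = 0)
    (hGreal : ∀ f : Site d → 𝔸, (∀ j, j ≤ k → ∀ x ∈ Ω j, IsSelfAdjoint (f x)) → ∀ x, IsSelfAdjoint (g f x))
    (hRbd : ∀ (f : Site d → 𝔸) (m : ℝ), 0 ≤ m → Bd2 L η k Ω f m → Bd2 L η k Ω (f - g (qs (c (q (g f))))) (BR * m))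
    (hRreal : ∀ f : Site d → 𝔸, (∀ j, j ≤ k → ∀ x ∈ Ω j, IsSelfAdjoint (f x)) →
      ∀ j, j ≤ k → ∀ x ∈ Ω j, IsSelfAdjoint ((f - g (qs (c (q (g f))))) x))
    (hDA : Bd2 L η k Ω (fun y => covDivB η U₀ A y) cDA) (hDAsa : ∀ j, j ≤ k → ∀ x ∈ Ω j, IsSelfAdjoint (covDivB η U₀ A x))
    (hA : ∀ j, j ≤ k → ∀ x ∈ Ω j, ∀ μ : Fin d,
      wt L η j * ‖A x μ‖ ≤ cA ∧ wt L η j * ‖conjR (U₀ (x - e μ) μ)⁻¹ (A (x - e μ) μ)‖ ≤ cA)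
    (hAsa : ∀ x μ, IsSelfAdjoint (A x μ))
    (h103 : BG * Mc d BR (α₄ / 4 + hE) cA hE₂ cDA ≤ α₄ / 4)
    (h106 : BG * Kc d BR (α₄ / 4 + hE) cA hE₂ cDA lE₂ (1 + lE) (1 + lE) ≤ 1 / 2) :
    ∃ lam : Site d → 𝔸, (∀ x, IsSelfAdjoint (lam x)) ∧ (∀ x, x ∉ Ω 0 → lam x = 0) ∧
      (∀ j, j ≤ k → ∀ p ∈ Eb j, ‖lam p.1‖ ≤ α₄ ∧ wt L η j * ‖covDerivFwd η U₀ p.2 lam p.1‖ ≤ α₄) ∧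
      (∃ μ : ℕ → Site d → 𝔸, ∀ x ∈ Ω 0,
        covLap η U₀ ((Ω 0).indicator fun y => covDivB η U₀ A y + covLap η U₀ lam y +
          ((conjR (gaugeExp lam y)⁻¹ (covDivB η U₀ A y) - covDivB η U₀ A y) +
            (gAd (covLap η U₀ lam y) (lam y) - covLap η U₀ lam y) + ∑ μ, frakF3 η U₀ lam A y μ)) x = QTZ L k Λs U₀ μ x) ∧
      Restr129Z L k Λs U₀ (u₁ * gaugeExp lam) := by
  have hL1 : 1 ≤ L := by omega
  have hC2 : 0 ≤ C2p d := C2p_nonneg d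
  have hC2pos : 0 < C2p d := by
    have hC6 : (2 : ℝ) ≤ C6 d := by unfold C6; linarith [one_le_C5 (d := d)]
    unfold C2p Cgen; positivity
  have hα₃ : (0 : ℝ) ≤ 20 * d * KZ d L * cB := alpha3Z_nonneg L hcB
  have hhE : 0 ≤ hE := by rw [hE_def]; positivity
  have hhE₂ : 0 ≤ hE₂ := by rw [hE₂_def]; positivity
  have hlE : 0 ≤ lE := by rw [lE_def]; positivity
  have hlE₂ : 0 ≤ lE₂ := by rw [lE₂_def]; positivity
  have hb₁ : 0 < α₄ / 4 + hE := add_pos_of_pos_of_nonneg (by positivity) hhE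
  -- `h₀ ≤ ¾α₄` from print's smallness in product form
  have hh₀' : hE ≤ 3 * α₄ / 4 := by
    have h8 := (B8SectEKLevelInLambda.smallness_prod_w (d := d) hα₃ hB hC2pos hsm).1
    have e1 : hE = (C2p d * (20 * d * KZ d L * cB + α₄) * B₀') * α₄ := by rw [hE_def]; ring
    rw [e1]
    calc C2p d * (20 * d * KZ d L * cB + α₄) * B₀' * α₄ ≤ 1 / 8 * α₄ := mul_le_mul_of_nonneg_right h8 hα₄.le
      _ ≤ 3 * α₄ / 4 := by linarith only [hα₄]
  -- THE solution map D′(u₁⁻¹, −i·) on the ¼α₄-ball (chosen once; Lipschitz; real on Hermitian λ)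
  obtain ⟨Dp, hDp, hDpL, hDpR⟩ := exists_Dprime_map hLs hs1 hη hU₀ H' hα hα3 hα4 hcB hα₄ hB h33 h69 hd hαP hαP3 hαP2 hBu hP hAx h129 hEbT hH0 hH1 hHequiv hQH
    hCequiv hsmall hc₃ hsc hα₃' hs₁ hs₂ hs₃ hs₄ hs₅ hs₆ hs₇ hsm
  -- sizes of D′ and of its differences, multiplied by the (1.92) constants
  have hbdX : ∀ s : lamSubK η U₀ L k Eb, ‖s‖ ≤ α₄ / 4 → B₀' * ‖Dp (lamOf s)‖ ≤ hE := fun s hs => by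
    rw [hE_def]; exact mul_le_mul_of_nonneg_left (hDp s hs).2.1 hB.le
  have hbdX₂ : ∀ s : lamSubK η U₀ L k Eb, ‖s‖ ≤ α₄ / 4 → B₂' * ‖Dp (lamOf s)‖ ≤ hE₂ := fun s hs => by
    rw [hE₂_def]; exact mul_le_mul_of_nonneg_left (hDp s hs).2.1 hB₂
  have hbdL : ∀ s t : lamSubK η U₀ L k Eb, ‖s‖ ≤ α₄ / 4 → ‖t‖ ≤ α₄ / 4 → B₀' * ‖Dp (lamOf s) - Dp (lamOf t)‖ ≤ lE * ‖s - t‖ :=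
    fun s t hs ht => by
    rw [lE_def, mul_assoc]; exact mul_le_mul_of_nonneg_left (hDpL s t hs ht) hB.le
  have hbdL₂ : ∀ s t : lamSubK η U₀ L k Eb, ‖s‖ ≤ α₄ / 4 → ‖t‖ ≤ α₄ / 4 → B₂' * ‖Dp (lamOf s) - Dp (lamOf t)‖ ≤ lE₂ * ‖s - t‖ :=
    fun s t hs ht => by
    rw [lE₂_def, mul_assoc]; exact mul_le_mul_of_nonneg_left (hDpL s t hs ht) hB₂
  have hsubH : ∀ s t : lamSubK η U₀ L k Eb, (-I) • H' (Dp (lamOf s)) - (-I) • H' (Dp (lamOf t)) = (-I) • H' (Dp (lamOf s) - Dp (lamOf t)) :=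
    fun s t => by rw [map_sub, smul_sub]
  -- the eight binders of JOIN-B for `H_c λ := −i·H′D′(u₁⁻¹, −iλ)`
  have hc0 : ∀ s : lamSubK η U₀ L k Eb, ‖s‖ ≤ α₄ / 4 → ∀ x, ‖((-I) • H' (Dp (lamOf s))) x‖ ≤ hE := fun s hs x => by
    rw [Pi.smul_apply, norm_negI_smul]; exact (hH0 _ x).trans (hbdX s hs)
  have hc1 : ∀ s : lamSubK η U₀ L k Eb, ‖s‖ ≤ α₄ / 4 → ∀ j, j ≤ k → ∀ p ∈ Eb j,
      wt L η j * ‖covDerivFwd η U₀ p.2 ((-I) • H' (Dp (lamOf s))) p.1‖ ≤ hE := fun s hs j hj p hp => by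
    rw [covDerivFwd_smul, norm_negI_smul]; exact (hH1 j hj _ p hp).trans (hbdX s hs)
  have hc2 : ∀ s : lamSubK η U₀ L k Eb, ‖s‖ ≤ α₄ / 4 → Bd2 L η k Ω (covLap η U₀ ((-I) • H' (Dp (lamOf s)))) hE₂ :=
    fun s hs j hj x hx => by
    rw [covLap_smul, norm_negI_smul]; exact (hH2 _ j hj x hx).trans (hbdX₂ s hs)
  have hcL0 : ∀ s t : lamSubK η U₀ L k Eb, ‖s‖ ≤ α₄ / 4 → ‖t‖ ≤ α₄ / 4 → ∀ x,
      ‖((-I) • H' (Dp (lamOf s))) x - ((-I) • H' (Dp (lamOf t))) x‖ ≤ lE * ‖s - t‖ := fun s t hs ht x => by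
    rw [← Pi.sub_apply, hsubH, Pi.smul_apply, norm_negI_smul]; exact (hH0 _ x).trans (hbdL s t hs ht)
  have hcL1 : ∀ s t : lamSubK η U₀ L k Eb, ‖s‖ ≤ α₄ / 4 → ‖t‖ ≤ α₄ / 4 → ∀ j, j ≤ k → ∀ p ∈ Eb j,
      wt L η j * ‖covDerivFwd η U₀ p.2 ((-I) • H' (Dp (lamOf s)) - (-I) • H' (Dp (lamOf t))) p.1‖ ≤ lE * ‖s - t‖ :=
    fun s t hs ht j hj p hp => by
    rw [hsubH, covDerivFwd_smul, norm_negI_smul]; exact (hH1 j hj _ p hp).trans (hbdL s t hs ht)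
  have hcL2 : ∀ s t : lamSubK η U₀ L k Eb, ‖s‖ ≤ α₄ / 4 → ‖t‖ ≤ α₄ / 4 →
      Bd2 L η k Ω (covLap η U₀ ((-I) • H' (Dp (lamOf s))) - covLap η U₀ ((-I) • H' (Dp (lamOf t)))) (lE₂ * ‖s - t‖) :=
    fun s t hs ht j hj x hx => by
    rw [Pi.sub_apply, ← covLap_sub, hsubH, covLap_smul, norm_negI_smul]; exact (hH2 _ j hj x hx).trans (hbdL₂ s t hs ht)
  have hcsa : ∀ s : lamSubK η U₀ L k Eb, ‖s‖ ≤ α₄ / 4 → (∀ x, IsSelfAdjoint (lamOf s x)) →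
      ∀ x, IsSelfAdjoint (((-I) • H' (Dp (lamOf s))) x) := fun s hs hsa x => by
    rw [Pi.smul_apply]
    refine isSelfAdjoint_negI_smul_of_skew ?_
    have hX : ∀ p, Dp (lamOf s) p = -star (Dp (lamOf s) p) := fun p => by rw [hDpR s hs hsa p, neg_neg]
    have h2 := congrArg star (hHequiv (Dp (lamOf s)) (Dp (lamOf s)) hX x)
    rw [star_neg, star_star] at h2
    exact h2
  have hcsupp : ∀ s : lamSubK η U₀ L k Eb, ‖s‖ ≤ α₄ / 4 → ∀ x, x ∉ Ω 0 → ((-I) • H' (Dp (lamOf s))) x = 0 := fun s _ x hx => by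
    rw [Pi.smul_apply, hHsupp _ x hx, smul_zero]
  -- «Q′(u₁⁻¹, e^{−iλ′}) = 0 on 𝔅_k» from (1.114), in the shape of the local route
  have h179E : ∀ s : lamSubK η U₀ L k Eb, ‖s‖ ≤ α₄ / 4 → q (lamOf s) = 0 →
      Cond179Z L k Λs U₀ (fun x => expUnit (((-I) • (lamOf s + (-I) • H' (Dp (lamOf s)))) x)) u₁⁻¹ := fun s hs hq0 =>
    cond179_of_eq114' H' q hq s (hDp s hs).2.2.2.2 hq0
  -- r04's Prop-10 windows at 8α₄ from the Sect. E windows at 2α₄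
  have hC6 : (0 : ℝ) ≤ C6 d := by
    have : (2 : ℝ) ≤ C6 d := by unfold C6; linarith only [one_le_C5 (d := d)]
    linarith only [this]
  have hw₁ : 10 * C6 d * (4 * (2 * α₄)) ≤ 1 := by nlinarith only [hs₁, hC6, hα₄.le]
  have hw₂ : 3000 * ((d : ℝ) + 1) * L * (4 * (2 * α₄)) ≤ 1 := by
    have e : 3000 * ((d : ℝ) + 1) * L * (4 * (2 * α₄)) = 12000 * ((d : ℝ) + 1) * L * (2 * α₄) := by ring
    rw [e]; exact hs₂
  exact hFP_kLevel_of179_local_RD hLs hs1 hη hd hU₀ hEbΩ hEbT g Δ q qs Aw c g_rightΩ c_range hΔ hqs (fun lam => (-I) • H' (Dp lam)) hα hα3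
    hα4 hcB hαP hαP3 hαP2 hBu h33 h69 hP hAx h129 hsmall hc₃ hsc hα₃' hw₁ hw₂ hs₃ hs₄ hs₅ hs₆ hprod hα₄ hBG hBR hhE hhE₂ hlE hlE hlE₂ hcA
    hcA' hcDA ha₁' hb₁' hb₁ hθ hh₀' hh₀' hG hGsupp hGreal hRbd hRreal hc0 hc1 hc2 hcL0 hcL1 hcL2 hcsa hcsupp hDA hDAsa hA hAsa h103 h106 h179E


end JoinLocal


/-! ## §3 `hCequiv` DISCHARGED, inverse laws on print's domains — [3]'s remainder covariance from `pub-ymgap-dag-n04-b`'s `B8SectERemainderCovariance` -/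

section JoinLocalReal

open B8SectERemainderCovarianceTowerRec (Cnl_negStar_inv_of_axial)

variable {L sL k : ℕ} {η : ℝ} {Ω Λs : ℕ → Set (Site d)} {Eb : ℕ → Set (Site d × Fin d)} {U₀ : Site d → Fin d → 𝔸ˣ}
  {A : Site d → Fin d → 𝔸} {u₁ : Site d → 𝔸ˣ}

/-- **JOIN-C, LOCAL ROUTE, WITH [3]'S REMAINDER COVARIANCE DISCHARGED, [4]'s INVERSE LAWS ON PRINT'S DOMAINS** —
`B8Prop5JoinSectELocal.hFP_kLevel_of_sectE_local'` VERBATIM except: no `g_left`; `g_rightΩ` (right inverse of `G′` pointwise on `Ω₀`, [4] Thm 3.1; dag-ref-A W8′) and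
`c_range` ((3.25); W8) in place of the total laws; this is the theorem the `SockHFP` providers of `B8SockHFPRD` instantiate.  As there: `hFP_kLevel_of_sectE_local` with its displayed law `hCequiv`
(`C′_j(u₁⁻¹, −μ⋆)(y) = −C′_j(u₁⁻¹, μ)(y)⋆` on the (1.120)-set of the tower) PROVED by `pub-ymgap-dag-n04-b`'s
`B8SectERemainderCovariance.Cnl_negStar_inv_of_axial` (θ-covariance `θ(w) = (w⋆)⁻¹` of the averages (78)–(80), of `ũ′` (178) and of the logarithm,
from the datum's regime AT `u₁`), and the two product windows merged into ONE: `2C₆(40d·c_B + 4α₄) ≤ ⅛` (`hprod8`; it gives r04's `4C₆α₄ ≤ ⅛` and the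
local inversion route's `2C₆(40d·c_B + 8α₄) < ½`).  After this the only displayed LAWS are those of [4]'s letters (`g Δ q qs Aw c`, `H′`: readings,
(1.91)–(1.92), (1.98)–(1.101), range, reality, `hHequiv`) — no hypothesis on a concrete tree object is left on the Sect. E / [3] side.
DISPLAYED otherwise as v1.1: the datum's tower-local regime AT `u₁`, tower bonds in `Eb j`, `G′`/`R`/datum binders, windows.  CONCLUSION: JOIN-B's.
[cite: Balaban1985RegularSpaces, Prop. 5 (1.107)–(1.109) p.94, (1.113)–(1.121) pp.95–97, p.93, (1.29) p.81; Balaban1985Averaging, (22)–(23) p.21, (78)–(80)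
p.30, (178) p.45, Prop. 10 (203)–(204) p.50, (213)–(214) p.50] -/
theorem hFP_kLevel_of_sectE_local'_RD (hLs : L = 2 * sL + 1) (hs1 : 1 ≤ sL) (hη : 0 < η) (hU₀ : ∀ x κ, U₀ x κ ∈ unitaryUnits 𝔸)
    (hEbΩ : ∀ j, j ≤ k → ∀ x ∈ Ω j, ∀ μ : Fin d, (x, μ) ∈ Eb j ∧ (x - e μ, μ) ∈ Eb j)
    (hEbT : ∀ j, j ≤ k → ∀ y ∈ Λs j, ∀ (x : Site d) (κ : Fin d), InBox (tlo L y j) (thi L y j) x →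
      InBox (tlo L y j) (thi L y j) (x + e κ) → (x, κ) ∈ Eb j)
    -- letters of [4]
    (g Δ : (Site d → 𝔸) →ₗ[ℂ] (Site d → 𝔸)) (q : (Site d → 𝔸) →ₗ[ℂ] (ℕ → Site d → 𝔸)) (qs : (ℕ → Site d → 𝔸) →ₗ[ℂ] (Site d → 𝔸))
    (Aw c : (ℕ → Site d → 𝔸) →ₗ[ℂ] (ℕ → Site d → 𝔸))
    (g_rightΩ : ∀ x, ∀ y ∈ Ω 0, (Δ (g x) + qs (Aw (q (g x)))) y = x y)
    (c_range : ∀ f, q (g (g (qs (c (q f))))) = q f)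
    (hΔ : ∀ (f : Site d → 𝔸), ∀ x ∈ Ω 0, Δ f x = covLap η U₀ ((Ω 0).indicator f) x)
    (hqs : ∀ (μ : ℕ → Site d → 𝔸), ∀ x ∈ Ω 0, qs μ x = QTZ L k Λs U₀ μ x)
    (hq : ∀ (f : Site d → 𝔸) (j : ℕ), j ≤ k → ∀ y ∈ Λs j, q f j y = QprimeIter (zdBlockingZ d L) (bgTZ L U₀) j f y)
    -- the letter H′ of [4] ((1.92)) and the Sect. E / local-inversion / covariance regime (tower-local, everything AT u₁)
    (H' : XSpace d k 𝔸 →ₗ[ℂ] (Site d → 𝔸)) {B : Site d → Fin d → 𝔸} {α₀ αP α₄ cB B₀' B₂' : ℝ}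
    (hα : 0 < α₀) (hα3 : C0Z d * α₀ ≤ 1 / 3) (hα4 : 4 * α₀ ≤ c2' d L) (hcB : 0 ≤ cB) (hα₄ : 0 < α₄) (hB : 0 < B₀') (hB₂ : 0 ≤ B₂')
    (h33 : ∀ j, j ≤ k → ∀ y ∈ Λs j, pdevOn (tlo L y j) (thi L y j) U₀ < α₀ * (((L : ℝ) ^ j)⁻¹) ^ 2)
    (h69 : ∀ j, j ≤ k → ∀ y ∈ Λs j, ∀ (x : Site d) (κ : Fin d), InBox (tlo L y j) (thi L y j) x →
      InBox (tlo L y j) (thi L y j) (x + e κ) → ‖B x κ‖ ≤ cB * ((L : ℝ) ^ j)⁻¹)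
    (hd : 1 ≤ d) (hαP : 0 < αP) (hαP3 : C0Z d * αP ≤ 1 / 3) (hαP2 : 2 * αP ≤ c2' d L)
    (hBu : ∀ (x : Site d) (κ : Fin d), expCfg B x κ ∈ unitaryUnits 𝔸)
    (hP : ∀ j, j ≤ k → ∀ y ∈ Λs j, pdevOn (tlo L y j) (thi L y j) (expCfg B * U₀) < αP * (((L : ℝ) ^ j)⁻¹) ^ 2)
    (hAx : InAxZ L k Λs U₀ (mgauge U₀ u₁ (expCfg B) * U₀)) (h129 : Restr129Z L k Λs U₀ u₁)
    (hH0 : ∀ (X : XSpace d k 𝔸) (x : Site d), ‖H' X x‖ ≤ B₀' * ‖X‖)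
    (hH1 : ∀ j, j ≤ k → ∀ (X : XSpace d k 𝔸), ∀ p ∈ Eb j, wt L η j * ‖covDerivFwd η U₀ p.2 (H' X) p.1‖ ≤ B₀' * ‖X‖)
    (hH2 : ∀ X : XSpace d k 𝔸, Bd2 L η k Ω (covLap η U₀ (H' X)) (B₂' * ‖X‖))
    (hHsupp : ∀ (X : XSpace d k 𝔸) (x : Site d), x ∉ Ω 0 → H' X x = 0)
    (hHequiv : ∀ X Y : XSpace d k 𝔸, (∀ p, Y p = -star (X p)) → ∀ x, H' Y x = -star (H' X x))
    (hQH : ∀ (Y : XSpace d k 𝔸) (j : ℕ) (hj : j ≤ k) (y : Site d), y ∈ Λs j →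
      QprimeIter (zdBlockingZ d L) (bgTZ L U₀) j (H' Y) y = Y (⟨j, Nat.lt_succ_of_le hj⟩, y))
    (hsmall : Real.exp (4 * cZ d * α₀) * (1 + 2 * (131072 * ((d : ℝ) + 1) ^ 2) * (KZ d L) ^ 2 * cB) ≤ 2)
    (hc₃ : KZ d L * cB ≤ c3 d L) (hsc : 1024 * (d : ℝ) * KZ d L * cB ≤ 1) (hα₃' : 20 * d * KZ d L * cB ≤ 1 / 200)
    (hs₁ : 200 * C6 d * (2 * α₄) ≤ 1) (hs₂ : 12000 * ((d : ℝ) + 1) * L * (2 * α₄) ≤ 1)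
    (hs₃ : C4G d L * (α₀ + 20 * d * KZ d L * cB + 4 * (2 * α₄)) ≤ 1)
    (hs₄ : 1024 * ((d : ℝ) + 1) * ((d : ℝ) + 4) * L ^ 2 * α₀ ≤ 1) (hs₅ : 32 * ((d : ℝ) + 1) ^ 2 * C6 d * L ^ 2 * α₀ ≤ 1)
    (hs₆ : 16 * d * C5' d * C6 d * (L : ℝ) ^ 2 * α₀ ≤ 1) (hs₇ : 8 * d * C6 d * L * α₀ ≤ 1)
    (hsm : 20 * d * KZ d L * cB + α₄ ≤ 1 / (4 * B₀' * (2 * C2p d))) (hprod8 : 2 * C6 d * (20 * d * KZ d L * cB + 4 * α₄) ≤ 1 / 8)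
    -- the Sect. E sizes of H_c (named, so that the windows below read)
    {hE hE₂ lE lE₂ : ℝ} (hE_def : hE = B₀' * (C2p d * (20 * d * KZ d L * cB + α₄) * α₄)) (hE₂_def : hE₂ = B₂' * (C2p d * (20 * d * KZ d L * cB + α₄) * α₄))
    (lE_def : lE = B₀' * (4 * C2p d * (20 * d * KZ d L * cB + 2 * α₄))) (lE₂_def : lE₂ = B₂' * (4 * C2p d * (20 * d * KZ d L * cB + 2 * α₄)))
    -- JOIN-B's letters G′, R, the datum, and its windows at these sizes
    {BG BR cA cDA : ℝ} (hBG : 0 ≤ BG) (hBR : 0 ≤ BR) (hcA : 0 ≤ cA) (hcA' : cA ≤ 1 / 13) (hcDA : 0 ≤ cDA)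
    (ha₁' : α₄ / 4 + hE ≤ 1 / 24) (hb₁' : α₄ / 4 + hE ≤ 1 / 140) (hθ : 10 * (α₄ / 4 + hE) * BR ≤ 1 / 2)
    (hG : ∀ (f : Site d → 𝔸) (m : ℝ), 0 ≤ m → Bd2 L η k Ω f m →
      (∀ x, ‖g f x‖ ≤ BG * m) ∧ ∀ j, j ≤ k → ∀ p ∈ Eb j, wt L η j * ‖covDerivFwd η U₀ p.2 (g f) p.1‖ ≤ BG * m)
    (hGsupp : ∀ (f : Site d → 𝔸) (x : Site d), x ∉ Ω 0 → g f x = 0)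
    (hGreal : ∀ f : Site d → 𝔸, (∀ j, j ≤ k → ∀ x ∈ Ω j, IsSelfAdjoint (f x)) → ∀ x, IsSelfAdjoint (g f x))
    (hRbd : ∀ (f : Site d → 𝔸) (m : ℝ), 0 ≤ m → Bd2 L η k Ω f m → Bd2 L η k Ω (f - g (qs (c (q (g f))))) (BR * m))
    (hRreal : ∀ f : Site d → 𝔸, (∀ j, j ≤ k → ∀ x ∈ Ω j, IsSelfAdjoint (f x)) →
      ∀ j, j ≤ k → ∀ x ∈ Ω j, IsSelfAdjoint ((f - g (qs (c (q (g f))))) x))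
    (hDA : Bd2 L η k Ω (fun y => covDivB η U₀ A y) cDA) (hDAsa : ∀ j, j ≤ k → ∀ x ∈ Ω j, IsSelfAdjoint (covDivB η U₀ A x))
    (hA : ∀ j, j ≤ k → ∀ x ∈ Ω j, ∀ μ : Fin d,
      wt L η j * ‖A x μ‖ ≤ cA ∧ wt L η j * ‖conjR (U₀ (x - e μ) μ)⁻¹ (A (x - e μ) μ)‖ ≤ cA)
    (hAsa : ∀ x μ, IsSelfAdjoint (A x μ))
    (h103 : BG * Mc d BR (α₄ / 4 + hE) cA hE₂ cDA ≤ α₄ / 4)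
    (h106 : BG * Kc d BR (α₄ / 4 + hE) cA hE₂ cDA lE₂ (1 + lE) (1 + lE) ≤ 1 / 2) :
    ∃ lam : Site d → 𝔸, (∀ x, IsSelfAdjoint (lam x)) ∧ (∀ x, x ∉ Ω 0 → lam x = 0) ∧
      (∀ j, j ≤ k → ∀ p ∈ Eb j, ‖lam p.1‖ ≤ α₄ ∧ wt L η j * ‖covDerivFwd η U₀ p.2 lam p.1‖ ≤ α₄) ∧
      (∃ μ : ℕ → Site d → 𝔸, ∀ x ∈ Ω 0,
        covLap η U₀ ((Ω 0).indicator fun y => covDivB η U₀ A y + covLap η U₀ lam y +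
          ((conjR (gaugeExp lam y)⁻¹ (covDivB η U₀ A y) - covDivB η U₀ A y) +
            (gAd (covLap η U₀ lam y) (lam y) - covLap η U₀ lam y) + ∑ μ, frakF3 η U₀ lam A y μ)) x = QTZ L k Λs U₀ μ x) ∧
      Restr129Z L k Λs U₀ (u₁ * gaugeExp lam) := by
  have hC6 : (0 : ℝ) ≤ C6 d := by
    have : (2 : ℝ) ≤ C6 d := by unfold C6; linarith only [one_le_C5 (d := d)]
    linarith only [this]
  have hα₃ : (0 : ℝ) ≤ 20 * d * KZ d L * cB := alpha3Z_nonneg L hcB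
  have hC4G : 0 ≤ C4G d L := by
    have h7 : (0 : ℝ) ≤ B7Prop10General.C7 d := by
      unfold B7Prop10General.C7 C6; linarith only [one_le_C5 (d := d), C5'_nonneg (d := d)]
    have h4' := C4'_nonneg (d := d)
    unfold C4G; positivity
  -- the local route's product window and (D)'s windows at 4α₄ from the Sect. E windows at 2α₄ and `hprod8`
  have hprod : 2 * C6 d * (20 * d * KZ d L * cB + 4 * (2 * α₄)) < 1 / 2 := by nlinarith only [hprod8, hC6, hα₃, hα₄.le]
  have h204w : C6 d * (4 * α₄) ≤ 1 / 8 := by nlinarith only [hprod8, hC6, hα₃, hα₄.le]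
  have hd₁ : 10 * C6 d * (4 * α₄) ≤ 1 := by nlinarith only [hs₁, hC6, hα₄.le]
  have hd₂ : 3000 * ((d : ℝ) + 1) * L * (4 * α₄) ≤ 1 := by
    have e : 3000 * ((d : ℝ) + 1) * L * (4 * α₄) = 12000 * ((d : ℝ) + 1) * L * (2 * α₄) / 2 := by ring
    rw [e]; linarith only [hs₂, show (0:ℝ) ≤ 12000 * ((d : ℝ) + 1) * L * (2 * α₄) by positivity]
  have hd₃ : C4G d L * (α₀ + 20 * d * KZ d L * cB + 4 * α₄) ≤ 1 :=
    (mul_le_mul_of_nonneg_left (by linarith only [hα₄]) hC4G).trans hs₃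
  have hCequiv := Cnl_negStar_inv_of_axial Λs hLs hs1 hd (by omega) hU₀ hα hα3 hα4 hcB hα₄ hαP hαP3 hαP2 hBu h33 h69 hP hAx h129
    hsmall hc₃ hsc (by linarith only [hα₃']) hd₁ hd₂ hd₃ hs₄ hs₅ hs₆ hprod8 h204w
  exact hFP_kLevel_of_sectE_local_RD hLs hs1 hη hU₀ hEbΩ hEbT g Δ q qs Aw c g_rightΩ c_range hΔ hqs hq H' hα hα3 hα4 hcB hα₄ hB hB₂ h33 h69
    hd hαP hαP3 hαP2 hBu hP hAx h129 hH0 hH1 hH2 hHsupp hHequiv hQH hCequiv hsmall hc₃ hsc hα₃' hs₁ hs₂ hs₃ hs₄ hs₅ hs₆ hs₇ hsm hprod hE_def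
    hE₂_def lE_def lE₂_def hBG hBR hcA hcA' hcDA ha₁' hb₁' hθ hG hGsupp hGreal hRbd hRreal hDA hDAsa hA hAsa h103 h106


end JoinLocalReal

end Literature.MathematicalPhysics.QuantumFieldTheory.Balaban1983to89.B8Prop5JoinSectELocalRDRec

end
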